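import Summits.AtomisticToContinuum.BoseEinsteinCondensation.Theorems.BECCutLineWeakDisorderGroundStateRigidityStubCoreCutoff
import Summits.AtomisticToContinuum.BoseEinsteinCondensation.Theorems.BECCutLineWeakDisorderGroundStateRigidityStubShellMassOfCutoff
import Summits.AtomisticToContinuum.BoseEinsteinCondensation.Theorems.BECCutLineWeakDisorderGroundStateRigidityStubLayerKineticVanishing
import Summits.AtomisticToContinuum.BoseEinsteinCondensation.Theorems.BECCutLineWeakDisorderGroundStateRigidityStubCutStateBound
import Summits.AtomisticToContinuum.BoseEinsteinCondensation.Theorems.BECCutLineWeakDisorderGroundStateRigidityStubLincombGroundState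
import Summits.AtomisticToContinuum.BoseEinsteinCondensation.Theorems.BECCutLineWeakDisorderGroundStateRigidityStubClosedEnergyTruncHardCoreAux
import Literature.MathematicalPhysics.QuantumManyBody.BoseGasHardCoreContact
import HarnessLib

/-!
# Route `BECHardSphereReduction`, crux `HardSphereBEC` (stmt-AtomisticToContinuum-11885),
# line `registered` (`Lines/birth.lean`): the registered stub `stub_diamRightContinuity`

Supports (does not close) stmt-AtomisticToContinuum-11885; stub `stub_diamRightContinuity` (S3)
of the birth line (lead c6). **Right-continuity of the hard-sphere ground-state energy in the
core diameter.** With `HS_r = ⊤ · 1_{(-∞, r]}` the hard-sphere pair potential of core diameter `r`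
and `E₀(v) = groundStateEnergy v N L` (Dirichlet box, `C¹` symmetric normalised trial states):
for all `N, L`, every `δ > 0` and `E₀(HS₁) < ∞` there is `θ > 0` with
`E₀(HS_{1+θ}) ≤ E₀(HS₁) + δ`.

## Proof (LSSY2005, proof of Thm 2.4: the core-cutoff machine of `GroundStateRigidity`)

Fix a tolerance `a > 0` with `4a < δ` and a near-minimiser `Ψ` of `HS₁`, `𝓔[Ψ] < E₀ + a`; finite
energy forces `Ψ = 0` wherever some pair is at distance `≤ 1` (`eq_zero_of_dist_le`), so its
energy is purely kinetic, `K = ∫|∇Ψ|² ≤ E₀ + a`. Choose the Young parameter `t > 0` with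
`t K < a` and a kinetic tolerance `ε` so small that `c₁ ε ≤ a` and `(E₀ + δ) c₀ ε ≤ a` for the
two bookkeeping constants below. By `stub_layerKineticVanishing` there is `s ∈ (0, 1/81]` with
`∫_{some pair ∈ (1-s, 1+3s)} |∇Ψ|² ≤ ε`; by `stub_shellMassOfCutoff` (inner cutoff of
`stub_coreCutoff` at radii `1 - s < 1`; the core term vanishes) every shell mass
`∫ 1{1 < |xᵢ - xⱼ| < 1 + 3s} |Ψ|²` is `≤ 288 s² ε`. Let `χ` be the cutoff of `stub_coreCutoff` at
radii `1 + s < 1 + 3s` (`χ = 0` where some pair is `≤ 1 + s`, `|∇χ|² ≤ A/(2s)²` in the layer) and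
`G = χΨ`. `stub_cutStateBound` (with `v = HS₁`, `b = 1`, `C = m = 0`, so `v ⊓ m = 0` and
`𝓔_{v ⊓ m}[Ψ] = K`) gives `∫|∇G|² ≤ (1+t) K + (1+t⁻¹)(A/(2s)²) N² 288 s² ε ≤ E₀ + 3a` and
`1 ≤ ∫|G|² + N² 288 s² ε`. Since `G` vanishes wherever some pair is `≤ 1 + s`, its `HS_{1+s}`
interaction vanishes identically, and the variational bound
(`LincombGS.exists_trialState_normalize`) reads `E₀(HS_{1+s}) ∫|G|² ≤ ∫|∇G|²`. If we had
`E₀(HS_{1+s}) > E₀ + δ`, then `E₀ + δ ≤ (E₀ + δ)(∫|G|² + ΣΣ shells) ≤ E₀ + 3a + a < E₀ + δ`,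
a contradiction; hence `θ = s` works.
-/

noncomputable section

open MeasureTheory Set
open scoped ENNReal NNReal

namespace Summit.AtomisticToContinuum.BoseEinsteinCondensation.Cruxes.HardSphereBEC.Birth

open Literature.MathematicalPhysics.QuantumManyBody.BoseGas
open Summit.AtomisticToContinuum.BoseEinsteinCondensation.Theorems.GroundStateRigidity

namespace DiamRightContinuity

variable {N : ℕ}

/-- The hard-sphere potential `HS_r = ⊤ · 1_{(-∞, r]}` vanishes beyond `r`. [folklore] -/
theorem hardSphere_eq_zero {r t : ℝ} (h : r < t) :
    (Set.Iic r).indicator (fun _ : ℝ => (⊤ : ℝ≥0∞)) t = 0 :=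
  indicator_of_notMem (fun ht => (not_le.2 h) (mem_Iic.1 ht)) _

/-- The hard-sphere potential `HS_r` is `⊤` up to distance `r`. [folklore] -/
theorem hardSphere_eq_top {r t : ℝ} (h : t ≤ r) :
    (Set.Iic r).indicator (fun _ : ℝ => (⊤ : ℝ≥0∞)) t = ⊤ :=
  indicator_of_mem (mem_Iic.2 h) _

/-- The `HS_r`-interaction term of a wave function vanishing wherever some pair is at distance
`≤ r` vanishes identically (either the wave function or every pair term is zero). [folklore] -/
theorem interaction_hardSphere_mul_eq_zero {r : ℝ} {G : Config N → ℂ}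
    (hG : ∀ X : Config N, (∃ i j : Fin N, i ≠ j ∧ dist (X i) (X j) ≤ r) → G X = 0)
    (X : Config N) :
    interaction ((Set.Iic r).indicator fun _ : ℝ => (⊤ : ℝ≥0∞)) X * (‖G X‖₊ : ℝ≥0∞) ^ 2 = 0 := by
  by_cases hX : ∃ i j : Fin N, i ≠ j ∧ dist (X i) (X j) ≤ r
  · rw [hG X hX, nnnorm_zero, ENNReal.coe_zero, zero_pow two_ne_zero, mul_zero]
  · push Not at hX
    rw [interaction_eq_zero_of_lt_dist (v := (Set.Iic r).indicator fun _ : ℝ => (⊤ : ℝ≥0∞))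
      (R₀ := r) (fun t ht => hardSphere_eq_zero ht) (fun i j hij => hX i j hij.ne), zero_mul]

/-- Truncating a pair potential at height `0` gives the free gas: the truncated energy is the
kinetic energy. [folklore] -/
theorem energy_min_natZero {L : ℝ} (v : ℝ → ℝ≥0∞) (Φ : TrialState N L) :
    energy (fun r => min (v r) ((0 : ℕ) : ℝ≥0∞)) Φ = ∫⁻ X, kineticDensity Φ.ψ X := by
  unfold energy
  refine lintegral_congr fun X => ?_
  have h0 : interaction (fun r => min (v r) ((0 : ℕ) : ℝ≥0∞)) X = 0 := by
    unfold interaction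
    refine Finset.sum_eq_zero fun i _ => Finset.sum_eq_zero fun j _ => ?_
    rw [Nat.cast_zero]
    exact min_eq_right zero_le
  rw [h0, zero_mul, add_zero]

/-- The mass `∫ 1_S |ψ|²` over an event `S` on which `ψ` vanishes is zero. [folklore] -/
theorem lintegral_indicator_normSq_eq_zero {S : Set (Config N)} {ψ : Config N → ℂ}
    (h : ∀ X ∈ S, ψ X = 0) :
    ∫⁻ X, S.indicator (fun Y => (‖ψ Y‖₊ : ℝ≥0∞) ^ 2) X = 0 := by
  refine (lintegral_congr fun X => ?_).trans lintegral_zero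
  by_cases hX : X ∈ S
  · rw [indicator_of_mem hX, h X hX, nnnorm_zero, ENNReal.coe_zero, zero_pow two_ne_zero]
  · exact indicator_of_notMem hX _

end DiamRightContinuity

open DiamRightContinuity in
/-- **S3 — RIGHT-CONTINUITY OF THE HARD-SPHERE GROUND-STATE ENERGY IN THE CORE DIAMETER.**
For all `N, L`, every `δ > 0` and `E₀(HS₁, N, L) < ∞` there is `θ > 0` with
`E₀(HS_{1+θ}, N, L) ≤ E₀(HS₁, N, L) + δ`, `HS_r = Set.indicator (Set.Iic r) ⊤`. Enlarge the unit
cores of ONE `C¹` near-minimiser `Ψ` by a thin shell: with the cutoffs of `stub_coreCutoff`, the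
vanishing layer kinetic energy (`stub_layerKineticVanishing`), the shell masses
(`stub_shellMassOfCutoff`) and the cut-state bounds (`stub_cutStateBound`), the cut state `χΨ`
vanishes wherever some pair is `≤ 1 + s`, has kinetic energy `≤ E₀ + 3a` and mass `≥ 1 - σ` with
`(E₀ + δ) σ ≤ a`, `4a < δ`; the variational bound for `HS_{1+s}`
(`LincombGS.exists_trialState_normalize`) concludes. [cite: LSSY2005, proof of Thm 2.4] -/
theorem stub_diamRightContinuity :
    ∀ (N : ℕ) (L : ℝ) (δ : ENNReal), 0 < δ → Literature.MathematicalPhysics.QuantumManyBody.BoseGas.groundStateEnergy (Set.indicator (Set.Iic 1) (fun _ : ℝ => (⊤ : ENNReal))) N L ≠ ⊤ → ∃ θ : ℝ, 0 < θ ∧ Literature.MathematicalPhysics.QuantumManyBody.BoseGas.groundStateEnergy (Set.indicator (Set.Iic (1 + θ)) (fun _ : ℝ => (⊤ : ENNReal))) N L ≤ Literature.MathematicalPhysics.QuantumManyBody.BoseGas.groundStateEnergy (Set.indicator (Set.Iic 1) (fun _ : ℝ => (⊤ : ENNReal))) N L + δ := by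
  intro N L δ hδ hE
  -- the case `δ = ⊤` is trivial
  rcases eq_or_ne δ ⊤ with hδt | hδt
  · exact ⟨1, one_pos, by rw [hδt, add_top]; exact le_top⟩
  set v : ℝ → ℝ≥0∞ := Set.indicator (Set.Iic 1) (fun _ : ℝ => (⊤ : ℝ≥0∞)) with hv_def
  -- a tolerance `a > 0` with `4a < δ`
  obtain ⟨n, hn0, hn4⟩ :=
    ENNReal.exists_nnreal_pos_mul_lt (by norm_num : (4 : ℝ≥0∞) ≠ ⊤) hδ.ne'
  set a : ℝ≥0∞ := (n : ℝ≥0∞) with ha_def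
  have ha0 : a ≠ 0 := ENNReal.coe_ne_zero.2 hn0.ne'
  have ha4 : groundStateEnergy v N L + (a + a + a + a) < groundStateEnergy v N L + δ := by
    refine ENNReal.add_lt_add_left hE ?_
    calc a + a + a + a = a * 4 := by ring
      _ < δ := hn4
  -- a near-minimiser `Ψ`; it vanishes wherever some pair is at distance `≤ 1`
  obtain ⟨Ψ, hΨ⟩ := iInf_lt_iff.1
    (ENNReal.lt_add_right hE ha0 : groundStateEnergy v N L < groundStateEnergy v N L + a)
  have hEΨ : energy v Ψ ≠ ⊤ := ne_top_of_lt hΨ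
  have hKE : ∫⁻ X, kineticDensity Ψ.ψ X ≤ energy v Ψ := lintegral_mono fun X => le_self_add
  have hKt : ∫⁻ X, kineticDensity Ψ.ψ X ≠ ⊤ := ne_top_of_le_ne_top hEΨ hKE
  have hKa : ∫⁻ X, kineticDensity Ψ.ψ X ≤ groundStateEnergy v N L + a := hKE.trans hΨ.le
  have hvcore : ∀ r, r < 1 → v r = ⊤ := fun r hr => hardSphere_eq_top hr.le
  have hΨ0 : ∀ (X : Config N) (i j : Fin N), i ≠ j → dist (X i) (X j) ≤ 1 → Ψ.ψ X = 0 :=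
    fun X i j hij hd => eq_zero_of_dist_le one_pos hvcore Ψ.contDiff.continuous hEΨ X i j hij hd
  have hcore_le : ∫⁻ X, {Y : Config N | ∃ i j : Fin N, i ≠ j ∧ dist (Y i) (Y j) ≤ 1}.indicator
      (fun Y => (‖Ψ.ψ Y‖₊ : ℝ≥0∞) ^ 2) X = 0 :=
    lintegral_indicator_normSq_eq_zero fun X hX => by
      obtain ⟨i, j, hij, hd⟩ := hX
      exact hΨ0 X i j hij hd
  have hcore_lt : ∫⁻ X, {Y : Config N | ∃ i j : Fin N, i ≠ j ∧ dist (Y i) (Y j) < 1}.indicator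
      (fun Y => (‖Ψ.ψ Y‖₊ : ℝ≥0∞) ^ 2) X = 0 :=
    lintegral_indicator_normSq_eq_zero fun X hX => by
      obtain ⟨i, j, hij, hd⟩ := hX
      exact hΨ0 X i j hij hd.le
  -- the cutoff constant `A = A(N)` and the Young parameter `t` with `t K < a`
  obtain ⟨A, hA⟩ := stub_coreCutoff N
  obtain ⟨t, ht0, htK⟩ := ENNReal.exists_nnreal_pos_mul_lt hKt ha0
  have ht0' : (0 : ℝ) < t := NNReal.coe_pos.2 ht0
  set T : ℝ≥0∞ := ENNReal.ofReal (1 + (t : ℝ)⁻¹) with hT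
  -- the bookkeeping constants and the kinetic tolerance `ε`
  set c₁ : ℝ≥0∞ := T * ENNReal.ofReal (72 * A) * ((N : ℝ≥0∞) * N) with hc₁
  set c₀ : ℝ≥0∞ := (N : ℝ≥0∞) * ((N : ℝ≥0∞) * ENNReal.ofReal 288) with hc₀
  set c : ℝ≥0∞ := c₁ + (groundStateEnergy v N L + δ) * c₀ with hc
  have hc₁t : c₁ ≠ ⊤ :=
    ENNReal.mul_ne_top (ENNReal.mul_ne_top ENNReal.ofReal_ne_top ENNReal.ofReal_ne_top)
      (ENNReal.mul_ne_top (ENNReal.natCast_ne_top N) (ENNReal.natCast_ne_top N))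
  have hc₀t : c₀ ≠ ⊤ :=
    ENNReal.mul_ne_top (ENNReal.natCast_ne_top N)
      (ENNReal.mul_ne_top (ENNReal.natCast_ne_top N) ENNReal.ofReal_ne_top)
  have hct : c ≠ ⊤ :=
    ENNReal.add_ne_top.2 ⟨hc₁t, ENNReal.mul_ne_top (ENNReal.add_ne_top.2 ⟨hE, hδt⟩) hc₀t⟩
  set ε : ℝ≥0∞ := a / c with hε_def
  have hε : 0 < ε := ENNReal.div_pos ha0 hct
  have hc₁ε : c₁ * ε ≤ a := (mul_le_mul' le_self_add le_rfl).trans ENNReal.mul_div_le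
  have hc₀ε : (groundStateEnergy v N L + δ) * c₀ * ε ≤ a :=
    (mul_le_mul' le_add_self le_rfl).trans ENNReal.mul_div_le
  -- the layer width `s ≤ 1/81`
  obtain ⟨s₀, hs₀, hs₀ε⟩ := stub_layerKineticVanishing N 1 Ψ.ψ Ψ.contDiff hKt ε hε
  set s : ℝ := min s₀ (1 / 81) with hs_def
  have hs : 0 < s := lt_min hs₀ (by norm_num)
  have hs81' : s ≤ 1 / 81 := min_le_right _ _
  have hs81 : 81 * s ≤ 1 := by linarith
  have hs1 : s ≤ 1 := by linarith
  have hss₀ : s ≤ s₀ := min_le_left _ _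
  set U : Set (Config N) := {Y | ∃ i j : Fin N, i ≠ j ∧ 1 - s < dist (Y i) (Y j) ∧
    dist (Y i) (Y j) < 1 + 3 * s} with hU
  have hlay : ∫⁻ X, U.indicator (kineticDensity Ψ.ψ) X ≤ ε := by
    refine (lintegral_mono fun X =>
      indicator_le_indicator_of_subset ?_ (fun _ => zero_le) X).trans hs₀ε
    rintro Y ⟨i, j, hij, h1, h2⟩
    exact ⟨i, j, hij, by linarith, by linarith⟩
  -- the inner cutoff `η` (radii `1 - s < 1`) and the shell masses
  obtain ⟨η, hηC, hη01, -, hη0, hη1, hηA⟩ := hA (1 - s) 1 (by linarith) (by linarith)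
  rw [sub_sub_cancel] at hηA
  have hshell : ∀ i j : Fin N, i ≠ j →
      ∫⁻ X, (shellPair 1 (3 * s) i j).indicator (fun Y => (‖Ψ.ψ Y‖₊ : ℝ≥0∞) ^ 2) X ≤
        ENNReal.ofReal (288 * s ^ 2) * ε := by
    intro i j hij
    refine (stub_shellMassOfCutoff N 1 s A η Ψ.ψ i j hij hs hs81 hηC hη01 hη0 hη1 hηA
      Ψ.contDiff).trans ?_
    rw [hcore_lt, mul_zero, add_zero]
    refine mul_le_mul' le_rfl ((lintegral_mono fun X => ?_).trans hlay)
    refine indicator_le_indicator_of_subset (fun Y hY => ?_) (fun _ => zero_le) X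
    exact ⟨i, j, hij, hY.1, by linarith [hY.2]⟩
  have hsum := ClosedEnergyTrunc.sum_sum_le hshell
  -- the outer cutoff `χ` (radii `1 + s < 1 + 3s`) and the cut-state bounds for `v = HS₁`
  obtain ⟨χ, hχC, hχ01, hχσ, hχ0, hχ1, hχA⟩ := hA (1 + s) (1 + 3 * s) (by linarith) (by linarith)
  have hχ0' : ∀ X : Config N, (∃ i j : Fin N, i ≠ j ∧ dist (X i) (X j) ≤ 1) → χ X = 0 :=
    fun X ⟨i, j, hij, hd⟩ => hχ0 X ⟨i, j, hij, hd.trans (by linarith)⟩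
  have hχA' : ∀ X : Config N, realKinetic χ X ≤
      {Y : Config N | ∃ i j : Fin N, i ≠ j ∧ 1 < dist (Y i) (Y j) ∧
          dist (Y i) (Y j) < 1 + 3 * s}.indicator
        (fun _ => ENNReal.ofReal ((A : ℝ) / ((1 + 3 * s) - (1 + s)) ^ 2)) X := fun X =>
    (hχA X).trans (indicator_le_indicator_of_subset
      (by
        rintro Y ⟨i, j, hij, h1, h2⟩
        exact ⟨i, j, hij, by linarith, h2⟩) (fun _ => zero_le) X)
  have hvm : Measurable v := measurable_const.indicator measurableSet_Iic
  have hcore1 : ∀ r : ℝ, r ∈ Set.Icc (0 : ℝ) 1 → v r = ⊤ := fun r hr => hardSphere_eq_top hr.2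
  have hC1 : ∀ r : ℝ, 1 < r → v r ≤ ((0 : ℝ≥0) : ℝ≥0∞) := fun r hr =>
    (hardSphere_eq_zero hr).trans_le zero_le
  obtain ⟨hQ, hmass, -⟩ := stub_cutStateBound N L v 1 s 0
    (Real.toNNReal ((A : ℝ) / ((1 + 3 * s) - (1 + s)) ^ 2)) 0 (t : ℝ) Ψ χ hvm one_pos hs
    (by norm_num) ht0' hcore1 hC1 hχC hχ01 hχ0' hχ1 hχA'
  rw [hcore_le, zero_add] at hmass
  rw [energy_min_natZero v Ψ] at hQ
  -- constants
  have h72 : (Real.toNNReal ((A : ℝ) / ((1 + 3 * s) - (1 + s)) ^ 2) : ℝ≥0∞) *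
      ENNReal.ofReal (288 * s ^ 2) = ENNReal.ofReal (72 * A) := by
    change ENNReal.ofReal _ * _ = _
    rw [← ENNReal.ofReal_mul (by positivity)]
    congr 1
    rw [show (1 + 3 * s) - (1 + s) = 2 * s by ring, div_mul_eq_mul_div, div_eq_iff (by positivity)]
    ring
  have h288 : ENNReal.ofReal (288 * s ^ 2) ≤ ENNReal.ofReal 288 := by
    refine ENNReal.ofReal_le_ofReal ?_
    have h := pow_le_one₀ (n := 2) hs.le hs1
    linarith
  have h1t : ENNReal.ofReal (1 + (t : ℝ)) = 1 + (t : ℝ≥0∞) := by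
    rw [ENNReal.ofReal_add zero_le_one (NNReal.coe_nonneg t), ENNReal.ofReal_one,
      ENNReal.ofReal_coe_nnreal]
  -- the kinetic energy of the cut state `χΨ`
  have hkin : ∫⁻ X, kineticDensity (fun Y => (χ Y : ℂ) * Ψ.ψ Y) X ≤
      groundStateEnergy v N L + a + a + a := by
    calc ∫⁻ X, kineticDensity (fun Y => (χ Y : ℂ) * Ψ.ψ Y) X
        ≤ ∫⁻ X, kineticDensity (fun Y => (χ Y : ℂ) * Ψ.ψ Y) X +
            interaction v X * (‖(χ X : ℂ) * Ψ.ψ X‖₊ : ℝ≥0∞) ^ 2 :=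
          lintegral_mono fun X => le_self_add
      _ ≤ _ := hQ
      _ ≤ (1 + (t : ℝ≥0∞)) * (∫⁻ X, kineticDensity Ψ.ψ X) +
            T * (Real.toNNReal ((A : ℝ) / ((1 + 3 * s) - (1 + s)) ^ 2) : ℝ≥0∞) *
              ((N : ℝ≥0∞) * ((N : ℝ≥0∞) * (ENNReal.ofReal (288 * s ^ 2) * ε))) := by
          rw [h1t]
          exact add_le_add le_rfl (mul_le_mul' le_rfl hsum)
      _ = (∫⁻ X, kineticDensity Ψ.ψ X) + (t : ℝ≥0∞) * (∫⁻ X, kineticDensity Ψ.ψ X) +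
            T * ((Real.toNNReal ((A : ℝ) / ((1 + 3 * s) - (1 + s)) ^ 2) : ℝ≥0∞) *
              ENNReal.ofReal (288 * s ^ 2)) * ((N : ℝ≥0∞) * N) * ε := by
          ring
      _ ≤ (groundStateEnergy v N L + a) + a + a := by
          rw [h72]
          exact add_le_add (add_le_add hKa htK.le) hc₁ε
  -- the shell-mass sum is small against `E₀ + δ`
  have hσ : (groundStateEnergy v N L + δ) *
      ∑ i : Fin N, ∑ j ∈ Finset.univ.erase i,
        ∫⁻ X, (shellPair 1 (3 * s) i j).indicator (fun Y => (‖Ψ.ψ Y‖₊ : ℝ≥0∞) ^ 2) X ≤ a := by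
    calc _ ≤ (groundStateEnergy v N L + δ) *
          ((N : ℝ≥0∞) * ((N : ℝ≥0∞) * (ENNReal.ofReal 288 * ε))) :=
          mul_le_mul' le_rfl (hsum.trans
            (mul_le_mul' le_rfl (mul_le_mul' le_rfl (mul_le_mul' h288 le_rfl))))
      _ = (groundStateEnergy v N L + δ) * c₀ * ε := by
          rw [hc₀]
          ring
      _ ≤ a := hc₀ε
  -- the cut state `G = χΨ`: `C¹`, Dirichlet, symmetric, vanishing on the enlarged cores
  have hGc : ContDiff ℝ 1 fun X => (χ X : ℂ) * Ψ.ψ X :=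
    (Complex.ofRealCLM.contDiff.comp hχC).mul Ψ.contDiff
  have hG0 : ∀ X, X ∉ boxN N L → (χ X : ℂ) * Ψ.ψ X = 0 := fun X hX => by
    rw [Ψ.eq_zero X hX, mul_zero]
  have hGσ : ∀ (σ : Equiv.Perm (Fin N)) (X : Config N),
      (χ (X ∘ σ) : ℂ) * Ψ.ψ (X ∘ σ) = (χ X : ℂ) * Ψ.ψ X := fun σ X => by
    rw [hχσ σ X, Ψ.symm σ X]
  have hGcore : ∀ X : Config N, (∃ i j : Fin N, i ≠ j ∧ dist (X i) (X j) ≤ 1 + s) →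
      (χ X : ℂ) * Ψ.ψ X = 0 := fun X hX => by
    rw [hχ0 X hX, Complex.ofReal_zero, zero_mul]
  refine ⟨s, hs, ?_⟩
  set w : ℝ → ℝ≥0∞ := Set.indicator (Set.Iic (1 + s)) (fun _ : ℝ => (⊤ : ℝ≥0∞)) with hw_def
  obtain ⟨_, -, hlow⟩ := LincombGS.exists_trialState_normalize Ψ w hGc hG0 hGσ
  have hR : (∫⁻ X, kineticDensity (fun Y => (χ Y : ℂ) * Ψ.ψ Y) X +
      interaction w X * (‖(χ X : ℂ) * Ψ.ψ X‖₊ : ℝ≥0∞) ^ 2) =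
        ∫⁻ X, kineticDensity (fun Y => (χ Y : ℂ) * Ψ.ψ Y) X :=
    lintegral_congr fun X => by rw [interaction_hardSphere_mul_eq_zero hGcore X, add_zero]
  have hlow' := hlow.trans_eq hR
  -- conclusion: `E₀(w) > E₀ + δ` would contradict `4a < δ`
  by_contra hcon
  have hlt := not_le.1 hcon
  have h1 : (groundStateEnergy v N L + δ) * ∫⁻ X, (‖(χ X : ℂ) * Ψ.ψ X‖₊ : ℝ≥0∞) ^ 2 ≤
      groundStateEnergy v N L + a + a + a :=
    ((mul_le_mul' hlt.le le_rfl).trans hlow').trans hkin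
  have h2 : groundStateEnergy v N L + δ ≤ groundStateEnergy v N L + (a + a + a + a) :=
    calc groundStateEnergy v N L + δ
        = (groundStateEnergy v N L + δ) * 1 := (mul_one _).symm
      _ ≤ (groundStateEnergy v N L + δ) * ((∫⁻ X, (‖(χ X : ℂ) * Ψ.ψ X‖₊ : ℝ≥0∞) ^ 2) +
            ∑ i : Fin N, ∑ j ∈ Finset.univ.erase i,
              ∫⁻ X, (shellPair 1 (3 * s) i j).indicator
                (fun Y => (‖Ψ.ψ Y‖₊ : ℝ≥0∞) ^ 2) X) := mul_le_mul' le_rfl hmass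
      _ = (groundStateEnergy v N L + δ) * (∫⁻ X, (‖(χ X : ℂ) * Ψ.ψ X‖₊ : ℝ≥0∞) ^ 2) +
            (groundStateEnergy v N L + δ) *
              ∑ i : Fin N, ∑ j ∈ Finset.univ.erase i,
                ∫⁻ X, (shellPair 1 (3 * s) i j).indicator
                  (fun Y => (‖Ψ.ψ Y‖₊ : ℝ≥0∞) ^ 2) X := mul_add _ _ _
      _ ≤ (groundStateEnergy v N L + a + a + a) + a := add_le_add h1 hσ
      _ = _ := by ring
  exact lt_irrefl _ (h2.trans_lt ha4)

end Summit.AtomisticToContinuum.BoseEinsteinCondensation.Cruxes.HardSphereBEC.Birth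

end
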